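import Summits.ResolutionOfSingularities.ResolutionOfSingularities.Theses.FoliationDescent
import HarnessLib

/-!
# Crux `FolLU` (stmt-ResolutionOfSingularities-17081), line `birth` — stub `stub_rescale_pClosed`

Route `ResolutionOfSingularities/FoliationDescent`. `p`-closedness of a derivation of a field of
characteristic `p` is stable under rescaling by a function: if `D^[p] = c · D` then
`(g • D)^[p] = c' · (g • D)` for some `c'`. This is the corollary of **Hochschild's formula**
[Hochschild1955, Lemma 1; Matsumura, *Commutative Ring Theory*, Thm. 25.5]: for a commutative ring
`A` of prime characteristic `p`, an additive Leibniz map `D : A → A`, `g ∈ A` and `δ := g · D`,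

  `δ^[p] x = g ^ p · D^[p] x + (δ^[p-1] g) · D x`.

Proof of the formula (universal-derivation trick, all elementary, namespace `…FolLU.Hochschild`):
* `normalForm`: `δ^[n] = ∑_{i ≤ n} β i · D^[i]` with `β 0 = 0`, `β n = g ^ n`, `β 1 = δ^[n-1] g`,
  the `β i` lying in any subset containing `0, g` and closed under `+, *, D` (induction on `n`);
* `iterate_mul` / `iterate_prime_mul`: the general Leibniz rule for `D^[n] (x y)`; in
  characteristic `p` the middle binomials vanish, so `D^[p]`, `δ^[p]` and hence
  `E := δ^[p] - g^p D^[p] - (δ^[p-1] g) D = ∑_{2 ≤ i < p} β i · D^[i]` satisfy the Leibniz rule;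
* `exists_extension`: `D` extends to `B := A[X₀, X₁, X₂, …]` (coefficientwise `D` plus the
  `A`-derivation `X₀ ↦ 1`, `X_{j+1} ↦ X_{j+2}`); running the above in `B` for `C g` (the `β i` are
  then constants `C (b i)`), the Leibniz defect of `E` at `X₀ · X₁` is `∑ C (b i) · i · X_i = 0`
  (`generic_defect`), whence `i · b i = 0`, so `b i = 0` for `2 ≤ i < p` (`i` is a unit mod `p`),
  i.e. `E = 0` on `B ⊇ A`.
-/

set_option linter.dupNamespace false -- mandated namespace of this single-conjunct summit

noncomputable section

open MvPolynomial Finset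

namespace Summit.ResolutionOfSingularities.ResolutionOfSingularities.Theorems.FolLU

namespace Hochschild

section General

variable {B : Type*} [CommRing B]

/-- An additive map satisfying the Leibniz rule kills `1`. [folklore] -/
theorem map_one_eq_zero (D : B →+ B) (hD : ∀ x y, D (x * y) = x * D y + y * D x) : D 1 = 0 := by
  have h := hD 1 1
  rw [one_mul, one_mul] at h
  have h2 : D 1 + D 1 = D 1 + 0 := by rw [add_zero]; exact h.symm
  exact add_left_cancel h2

/-- A rescaling `δ = g · D` of a Leibniz map is a Leibniz map. [folklore] -/
theorem leibniz_of_rescale (D δ : B →+ B) (hD : ∀ x y, D (x * y) = x * D y + y * D x) (g : B)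
    (hδ : ∀ y, δ y = g * D y) (x y : B) : δ (x * y) = x * δ y + y * δ x := by
  rw [hδ, hδ, hδ, hD]; ring

/-- **General Leibniz rule** for the iterates of an additive Leibniz map:
`D^[n] (x y) = ∑_{i + j = n} (n choose i) D^[i] x · D^[j] y`. [folklore] -/
theorem iterate_mul (D : B →+ B) (hD : ∀ x y, D (x * y) = x * D y + y * D x) (n : ℕ)
    (x y : B) :
    (⇑D)^[n] (x * y) =
      ∑ ij ∈ antidiagonal n, n.choose ij.1 • ((⇑D)^[ij.1] x * (⇑D)^[ij.2] y) := by
  induction n with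
  | zero => simp
  | succ n ih =>
    rw [sum_antidiagonal_choose_succ_nsmul (M := B) (fun i j => (⇑D)^[i] x * (⇑D)^[j] y) n,
      Function.iterate_succ_apply', ih, map_sum]
    simp only [map_nsmul, hD, smul_add, sum_add_distrib, Function.iterate_succ_apply']
    congr 1
    refine sum_congr rfl fun ij hij => ?_
    rw [Nat.choose_symm_of_eq_add (Finset.HasAntidiagonal.mem_antidiagonal.1 hij).symm, mul_comm]

/-- **`p`-th iterate of a Leibniz map is a Leibniz map in characteristic `p`**: the middle
binomial coefficients `p choose i`, `0 < i < p`, vanish. [folklore] -/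
theorem iterate_prime_mul {p : ℕ} (hp : p.Prime) [CharP B p] (D : B →+ B)
    (hD : ∀ x y, D (x * y) = x * D y + y * D x) (x y : B) :
    (⇑D)^[p] (x * y) = x * (⇑D)^[p] y + y * (⇑D)^[p] x := by
  obtain ⟨m, rfl⟩ := Nat.exists_eq_add_of_le' hp.two_le
  rw [iterate_mul D hD, Nat.sum_antidiagonal_succ, Nat.sum_antidiagonal_succ',
    sum_eq_zero (s := antidiagonal m)]
  · simp [mul_comm]
  · intro ij hij
    rw [Finset.HasAntidiagonal.mem_antidiagonal] at hij
    have hdvd : m + 2 ∣ (m + 2).choose (ij.1 + 1) :=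
      hp.dvd_choose_self (Nat.succ_ne_zero _) (by omega)
    rw [nsmul_eq_mul, (CharP.cast_eq_zero_iff B (m + 2) _).2 hdvd, zero_mul]

/-- **Normal form of the iterates of a rescaled derivation.** For `δ = g · D` and `n ≥ 1`:
`δ^[n] = ∑_{i ≤ n} β i · D^[i]` with `β 0 = 0`, `β n = g ^ n`, `β 1 = δ^[n-1] g`, `β i = 0` for
`i > n`, and all `β i` in any subset `P ∋ 0, g` closed under `+`, `*` and `D` (the recursion is
`β' i = g (D (β i) + β (i-1))`). [cite: Hochschild1955, Lemma 1] -/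
theorem normalForm (D δ : B →+ B) (hD : ∀ x y, D (x * y) = x * D y + y * D x) (g : B)
    (hδ : ∀ y, δ y = g * D y) (P : B → Prop) (hP0 : P 0) (hPadd : ∀ a b, P a → P b → P (a + b))
    (hPmul : ∀ a b, P a → P b → P (a * b)) (hPD : ∀ a, P a → P (D a)) (hPg : P g)
    (n : ℕ) (hn : 1 ≤ n) :
    ∃ β : ℕ → B, (∀ i, P (β i)) ∧ β 0 = 0 ∧ β n = g ^ n ∧ β 1 = (⇑δ)^[n - 1] g ∧
      (∀ i, n < i → β i = 0) ∧
      ∀ y, (⇑δ)^[n] y = ∑ i ∈ range (n + 1), β i * (⇑D)^[i] y := by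
  induction n, hn using Nat.le_induction with
  | base =>
    refine ⟨fun i => if i = 1 then g else 0, fun i => ?_, by simp, by simp, by simp,
      fun i hi => ?_, fun y => ?_⟩
    · dsimp only
      split_ifs
      exacts [hPg, hP0]
    · simp [show i ≠ 1 by omega]
    · simp [hδ]
  | succ n hn ih =>
    obtain ⟨β, hP, h0, htop, h1, hvan, hsum⟩ := ih
    refine ⟨fun i => g * D (β i) + if i = 0 then 0 else g * β (i - 1), fun i => ?_, ?_, ?_, ?_,
      fun i hi => ?_, fun y => ?_⟩
    · refine hPadd _ _ (hPmul _ _ hPg (hPD _ (hP i))) ?_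
      split_ifs
      exacts [hP0, hPmul _ _ hPg (hP _)]
    · simp [h0]
    · dsimp only
      rw [hvan (n + 1) (lt_add_one n), map_zero, mul_zero, zero_add, if_neg (Nat.succ_ne_zero n),
        Nat.add_sub_cancel, htop]
      exact (pow_succ' g n).symm
    · have e : (⇑δ)^[n] g = δ ((⇑δ)^[n - 1] g) := by
        obtain ⟨n', rfl⟩ : ∃ n', n = n' + 1 := ⟨n - 1, (Nat.sub_add_cancel hn).symm⟩
        rw [Nat.add_sub_cancel, Function.iterate_succ_apply']
      dsimp only
      rw [if_neg one_ne_zero, Nat.sub_self, h0, mul_zero, add_zero, h1, Nat.add_sub_cancel, ← hδ, e]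
    · dsimp only
      rw [hvan i (by omega), hvan (i - 1) (by omega), map_zero, mul_zero, zero_add, ite_self]
    · have key : ∑ i ∈ range (n + 1), g * D (β i) * (⇑D)^[i] y =
          ∑ i ∈ range (n + 1), g * D (β (i + 1)) * (⇑D)^[i + 1] y := by
        have e1 : ∑ i ∈ range (n + 1 + 1), g * D (β i) * (⇑D)^[i] y =
            ∑ i ∈ range (n + 1), g * D (β i) * (⇑D)^[i] y := by
          rw [sum_range_succ _ (n + 1), hvan (n + 1) (lt_add_one n), map_zero, mul_zero, zero_mul,
            add_zero]
        have e2 : ∑ i ∈ range (n + 1 + 1), g * D (β i) * (⇑D)^[i] y =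
            ∑ i ∈ range (n + 1), g * D (β (i + 1)) * (⇑D)^[i + 1] y := by
          rw [sum_range_succ' _ (n + 1), h0, map_zero, mul_zero, zero_mul, add_zero]
        rw [← e1, e2]
      rw [Function.iterate_succ_apply', hsum, hδ, map_sum, mul_sum, sum_range_succ' _ (n + 1)]
      simp only [Nat.succ_ne_zero, if_false, if_true, Nat.add_sub_cancel, h0, map_zero,
        mul_zero, add_zero, zero_mul]
      calc ∑ i ∈ range (n + 1), g * D (β i * (⇑D)^[i] y)
          = ∑ i ∈ range (n + 1), g * β i * (⇑D)^[i + 1] y +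
              ∑ i ∈ range (n + 1), g * D (β i) * (⇑D)^[i] y := by
            rw [← sum_add_distrib]
            refine sum_congr rfl fun i _ => ?_
            rw [hD, Function.iterate_succ_apply']
            ring
        _ = ∑ i ∈ range (n + 1), g * β i * (⇑D)^[i + 1] y +
              ∑ i ∈ range (n + 1), g * D (β (i + 1)) * (⇑D)^[i + 1] y := by rw [key]
        _ = ∑ i ∈ range (n + 1), (g * D (β (i + 1)) + g * β i) * (⇑D)^[i + 1] y := by
            rw [← sum_add_distrib]
            refine sum_congr rfl fun i _ => ?_
            ring

/-- The `p`-th normal form rearranged: `E := δ^[p] - g^p D^[p] - (δ^[p-1] g) D` is the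
combination `∑_{2 ≤ i < p} β i · D^[i]` of the MIDDLE iterates. [cite: Hochschild1955, Lemma 1] -/
theorem middleSum (D δ : B →+ B) (hD : ∀ x y, D (x * y) = x * D y + y * D x) (g : B)
    (hδ : ∀ y, δ y = g * D y) (P : B → Prop) (hP0 : P 0) (hPadd : ∀ a b, P a → P b → P (a + b))
    (hPmul : ∀ a b, P a → P b → P (a * b)) (hPD : ∀ a, P a → P (D a)) (hPg : P g)
    (p : ℕ) (hp : 2 ≤ p) :
    ∃ β : ℕ → B, (∀ i, P (β i)) ∧
      ∀ y, (⇑δ)^[p] y - g ^ p * (⇑D)^[p] y - (⇑δ)^[p - 1] g * D y =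
        ∑ i ∈ Ico 2 p, β i * (⇑D)^[i] y := by
  obtain ⟨β, hP, h0, htop, h1, -, hsum⟩ :=
    normalForm D δ hD g hδ P hP0 hPadd hPmul hPD hPg p (by omega)
  refine ⟨β, hP, fun y => ?_⟩
  rw [hsum, sum_range_succ, sum_range_eq_add_Ico _ (by omega : 0 < p),
    sum_eq_sum_Ico_succ_bot (by omega : 1 < p), h0, htop, h1]
  simp only [zero_mul, zero_add, Function.iterate_one]
  ring

end General

section Universal

variable {A : Type*} [CommRing A]

/-- **The universal extension.** An additive Leibniz map `D` of `A` extends to an additive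
Leibniz map `D'` of `B := A[X₀, X₁, …]` with `D' (C a) = C (D a)`, `D' X₀ = 1` and
`D' X_{j+1} = X_{j+2}`: the sum of the coefficientwise action of `D` and of the `A`-derivation
with the prescribed values on the variables. [cite: Hochschild1955, Lemma 1] -/
theorem exists_extension (D : A →+ A) (hD : ∀ x y, D (x * y) = x * D y + y * D x) :
    ∃ D' : MvPolynomial ℕ A →+ MvPolynomial ℕ A,
      (∀ x y, D' (x * y) = x * D' y + y * D' x) ∧ (∀ a, D' (C a) = C (D a)) ∧
      D' (X 0) = 1 ∧ ∀ j, D' (X (j + 1)) = X (j + 2) := by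
  classical
  let Dc : MvPolynomial ℕ A →+ MvPolynomial ℕ A :=
    { toFun := AddMonoidAlgebra.map D
      map_zero' := AddMonoidAlgebra.map_zero D
      map_add' := AddMonoidAlgebra.map_add D }
  have hc : ∀ m q, coeff m (Dc q) = D (coeff m q) := fun _ _ => rfl
  have hcX : ∀ n, Dc (X n) = 0 := fun n => by
    refine MvPolynomial.ext _ _ fun m => ?_
    rw [hc, coeff_X, coeff_zero]
    split_ifs
    · exact map_one_eq_zero D hD
    · exact map_zero D
  let Dx : Derivation A (MvPolynomial ℕ A) (MvPolynomial ℕ A) :=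
    mkDerivation A fun n => if n = 0 then 1 else X (n + 1)
  have hx : ∀ n, Dx (X n) = if n = 0 then 1 else X (n + 1) := fun n => mkDerivation_X _ _ _
  refine ⟨Dc + Dx.toLinearMap.toAddMonoidHom, fun x y => ?_, fun a => ?_, ?_, fun j => ?_⟩
  · have hcm : Dc (x * y) = x * Dc y + y * Dc x := by
      refine MvPolynomial.ext _ _ fun m => ?_
      rw [mul_comm y (Dc x), coeff_add, hc, coeff_mul, coeff_mul, coeff_mul, map_sum]
      simp only [hD, hc, sum_add_distrib]
      exact congr_arg₂ (· + ·) rfl (sum_congr rfl fun _ _ => mul_comm _ _)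
    simp only [AddMonoidHom.add_apply, LinearMap.toAddMonoidHom_coe, Derivation.coeFn_coe,
      Derivation.leibniz, smul_eq_mul, hcm]
    ring
  · simp only [AddMonoidHom.add_apply, LinearMap.toAddMonoidHom_coe, Derivation.coeFn_coe,
      derivation_C, add_zero]
    refine MvPolynomial.ext _ _ fun m => ?_
    rw [hc, coeff_C, coeff_C]
    split_ifs
    · rfl
    · exact map_zero D
  · simp only [AddMonoidHom.add_apply, LinearMap.toAddMonoidHom_coe, Derivation.coeFn_coe, hcX,
      hx, if_true, zero_add]
  · simp only [AddMonoidHom.add_apply, LinearMap.toAddMonoidHom_coe, Derivation.coeFn_coe, hcX,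
      hx, Nat.succ_ne_zero, if_false, zero_add]

/-- **The generic Leibniz defect.** In `A[X₀, X₁, …]` with `D' X₀ = 1`, `D' X_{j+1} = X_{j+2}`,
for `i ≥ 2`: `D'^[i] (X₀ X₁) - X₀ D'^[i] X₁ - X₁ D'^[i] X₀ = i · X_i` (only the term
`(i choose 1) D' X₀ · D'^[i-1] X₁` of the general Leibniz rule survives).
[cite: Hochschild1955, Lemma 1] -/
theorem generic_defect (D' : MvPolynomial ℕ A →+ MvPolynomial ℕ A)
    (hD' : ∀ x y, D' (x * y) = x * D' y + y * D' x) (h0 : D' (X 0) = 1)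
    (h1 : ∀ j, D' (X (j + 1)) = X (j + 2)) (i : ℕ) (hi : 2 ≤ i) :
    (⇑D')^[i] (X 0 * X 1) - X 0 * (⇑D')^[i] (X 1) - X 1 * (⇑D')^[i] (X 0) =
      (i : MvPolynomial ℕ A) * X i := by
  have hX1 : ∀ n, (⇑D')^[n] (X 1) = X (n + 1) := by
    intro n
    induction n with
    | zero => rfl
    | succ n ih => rw [Function.iterate_succ_apply', ih, h1]
  have hX0 : ∀ n, (⇑D')^[n + 1 + 1] (X 0) = 0 := by
    intro n
    rw [Function.iterate_succ_apply, Function.iterate_succ_apply, h0, map_one_eq_zero D' hD',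
      iterate_map_zero]
  obtain ⟨m, rfl⟩ := Nat.exists_eq_add_of_le' hi
  rw [iterate_mul D' hD', Nat.sum_antidiagonal_succ, Nat.sum_antidiagonal_succ,
    sum_eq_zero (s := antidiagonal m) fun ij _ => by rw [hX0, zero_mul, smul_zero]]
  have e2 : m + 2 = m + 1 + 1 := rfl
  simp only [e2, hX0, hX1, zero_add, Function.iterate_one, h0, Nat.choose_zero_right,
    Nat.choose_one_right, one_smul, Function.iterate_zero_apply, one_mul, add_zero, mul_zero,
    sub_zero, add_sub_cancel_left, nsmul_eq_mul]

/-- Coefficient extraction: the coefficient of `X_i` in `∑_{j ∈ s} C (b j) · j · X_j` is `b i · i`.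
[folklore] -/
theorem coeff_single_sum (b : ℕ → A) (s : Finset ℕ) (i : ℕ) (hi : i ∈ s) :
    coeff (Finsupp.single i 1) (∑ j ∈ s, C (b j) * ((j : MvPolynomial ℕ A) * X j)) = b i * i := by
  classical
  rw [coeff_sum]
  simp_rw [← mul_assoc, ← map_natCast (C : A →+* MvPolynomial ℕ A), ← map_mul, coeff_C_mul,
    coeff_X, Finsupp.single_left_inj one_ne_zero, mul_ite, mul_one, mul_zero]
  rw [sum_ite_eq' s i, if_pos hi]

/-- In characteristic `p`, `b · i = 0` with `0 < i < p` forces `b = 0` (`i` is a unit modulo `p`,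
by Fermat's little theorem `i^(p-1) ≡ 1`). [folklore] -/
theorem eq_zero_of_mul_natCast {p : ℕ} (hp : p.Prime) [CharP A p] {i : ℕ} (hi0 : i ≠ 0)
    (hip : i < p) {b : A} (h : b * i = 0) : b = 0 := by
  have hcop : i.Coprime p := (Nat.coprime_of_lt_prime hi0 hip hp).symm
  have h1 : (i : A) ^ (p - 1) = 1 := by
    rw [← Nat.cast_pow, CharP.natCast_eq_natCast' A p (Nat.ModEq.pow_card_sub_one_eq_one hp hcop),
      Nat.cast_one]
  obtain ⟨m, rfl⟩ := Nat.exists_eq_add_of_le' hp.two_le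
  have hm : m + 2 - 1 = m + 1 := rfl
  rw [hm] at h1
  calc b = b * (i : A) ^ (m + 1) := by rw [h1, mul_one]
    _ = b * i * (i : A) ^ m := by ring
    _ = 0 := by rw [h, zero_mul]

/-- **Hochschild's formula** (bundled form). For a commutative ring `A` of prime characteristic
`p`, an additive Leibniz map `D`, `g ∈ A` and `δ = g · D`:
`δ^[p] x = g ^ p · D^[p] x + (δ^[p-1] g) · D x`.
[cite: Hochschild1955, Lemma 1] -/
theorem formula_addMonoidHom {p : ℕ} (hp : p.Prime) [CharP A p] (D δ : A →+ A)
    (hD : ∀ x y, D (x * y) = x * D y + y * D x) (g : A) (hδ : ∀ y, δ y = g * D y) (x : A) :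
    (⇑δ)^[p] x = g ^ p * (⇑D)^[p] x + (⇑δ)^[p - 1] g * D x := by
  obtain ⟨D', hD', hC, hX0, hX1⟩ := exists_extension D hD
  let δ' : MvPolynomial ℕ A →+ MvPolynomial ℕ A := (AddMonoidHom.mulLeft (C g)).comp D'
  have hδ' : ∀ w, δ' w = C g * D' w := fun _ => rfl
  have hδ'mul := leibniz_of_rescale D' δ' hD' (C g) hδ'
  have hDn : ∀ n a, (⇑D')^[n] (C a) = C ((⇑D)^[n] a) := by
    intro n
    induction n with
    | zero => intro a; rfl
    | succ n ih =>
      intro a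
      rw [Function.iterate_succ_apply', ih, hC, Function.iterate_succ_apply']
  have hδn : ∀ n a, (⇑δ')^[n] (C a) = C ((⇑δ)^[n] a) := by
    intro n
    induction n with
    | zero => intro a; rfl
    | succ n ih =>
      intro a
      rw [Function.iterate_succ_apply', ih, hδ', hC, ← map_mul, ← hδ, Function.iterate_succ_apply']
  obtain ⟨β, hP, hE⟩ := middleSum D' δ' hD' (C g) hδ' (fun w => ∃ a, w = C a)
    ⟨0, (map_zero C).symm⟩ (by rintro _ _ ⟨a, rfl⟩ ⟨b, rfl⟩; exact ⟨a + b, (map_add C a b).symm⟩)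
    (by rintro _ _ ⟨a, rfl⟩ ⟨b, rfl⟩; exact ⟨a * b, (map_mul C a b).symm⟩)
    (by rintro _ ⟨a, rfl⟩; exact ⟨D a, hC a⟩) ⟨g, rfl⟩ p hp.two_le
  choose b hb using hP
  -- the Leibniz defect of `E` vanishes; evaluate it at the generic pair `X₀ · X₁`
  have hdef : ∀ y z : MvPolynomial ℕ A,
      (∑ i ∈ Ico 2 p, β i * (⇑D')^[i] (y * z)) - y * (∑ i ∈ Ico 2 p, β i * (⇑D')^[i] z) -
        z * (∑ i ∈ Ico 2 p, β i * (⇑D')^[i] y) = 0 := by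
    intro y z
    rw [← hE, ← hE, ← hE, iterate_prime_mul hp δ' hδ'mul y z, iterate_prime_mul hp D' hD' y z,
      hD' y z]
    ring
  have key : ∑ i ∈ Ico 2 p, C (b i) * ((i : MvPolynomial ℕ A) * X i) = 0 := by
    rw [← hdef (X 0) (X 1)]
    simp only [mul_sum, ← sum_sub_distrib]
    refine sum_congr rfl fun i hi => ?_
    rw [← generic_defect D' hD' hX0 hX1 i (mem_Ico.1 hi).1, hb i]
    ring
  have hb0 : ∀ i ∈ Ico 2 p, b i = 0 := by
    intro i hi
    obtain ⟨h2i, hip⟩ := mem_Ico.1 hi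
    have hc := congr_arg (coeff (Finsupp.single i 1)) key
    rw [coeff_single_sum b _ i hi, coeff_zero] at hc
    exact eq_zero_of_mul_natCast hp (by omega) hip hc
  -- specialise `E = 0` to the constant `C x`
  have hfin := hE (C x)
  rw [sum_eq_zero fun i hi => by rw [hb i, hb0 i hi, map_zero, zero_mul], hδn, hDn, hδn, hC,
    ← map_pow C, ← map_mul C, ← map_mul C, ← map_sub C, ← map_sub C, C_eq_zero, sub_sub,
    sub_eq_zero] at hfin
  exact hfin

/-- **Hochschild's formula** [Hochschild1955, Lemma 1; Matsumura, *Commutative Ring Theory*,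
Thm. 25.5]. Let `A` be a commutative ring of prime characteristic `p`, `D : A → A` additive with
`D (x y) = x D y + y D x`, `g ∈ A`, and `δ = g · D`. Then for all `x`,
`δ^[p] x = g ^ p · D^[p] x + (δ^[p-1] g) · D x`; in particular `(g D)^p ∈ A · D^p + A · D`.
[cite: Hochschild1955, Lemma 1] -/
theorem formula {p : ℕ} (hp : p.Prime) [CharP A p] (D δ : A → A)
    (hadd : ∀ x y, D (x + y) = D x + D y) (hD : ∀ x y, D (x * y) = x * D y + y * D x) (g : A)
    (hδ : ∀ y, δ y = g * D y) (x : A) :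
    δ^[p] x = g ^ p * D^[p] x + δ^[p - 1] g * D x := by
  have hδadd : ∀ x y, δ (x + y) = δ x + δ y := fun x y => by rw [hδ, hδ, hδ, hadd, mul_add]
  exact formula_addMonoidHom hp (AddMonoidHom.mk' D hadd) (AddMonoidHom.mk' δ hδadd) hD g hδ x

end Universal

end Hochschild

/-- STUB `stub_rescale_pClosed` of crux `FolLU`, line `birth`: **`p`-closedness is stable under
rescaling.** If `D` is a `k`-derivation of a field `K ⊇ k` of characteristic `p` with
`D^[p] = c · D`, then for every `g ∈ K` there is `c'` with `(g • D)^[p] = c' · (g • D)`: by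
Hochschild's formula `(g • D)^[p] x = (g ^ p c + (g • D)^[p-1] g) · D x`, so
`c' := (g ^ p c + (g • D)^[p-1] g) / g` works for `g ≠ 0`, and `c' := 0` for `g = 0`.
[cite: Hochschild1955, Lemma 1] -/
theorem stub_rescale_pClosed :
  ∀ p : ℕ, p.Prime → ∀ (k K : Type) [Field k] [CharP k p] [Field K] [Algebra k K]
    (D : Derivation k K K), (∃ c : K, ∀ x : K, (⇑D)^[p] x = c * D x) →
    ∀ g : K, ∃ c' : K, ∀ x : K, (⇑(g • D))^[p] x = c' * (g • D) x := by
  intro p hp k K _ _ _ _ D hc g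
  obtain ⟨c, hc⟩ := hc
  haveI : CharP K p := charP_of_injective_algebraMap (algebraMap k K).injective p
  have hD : ∀ x y : K, D (x * y) = x * D y + y * D x := fun x y => by
    rw [Derivation.leibniz, smul_eq_mul, smul_eq_mul]
  have hδ : ∀ y : K, (g • D) y = g * D y := fun y => by rw [Derivation.smul_apply, smul_eq_mul]
  have H : ∀ x : K, (⇑(g • D))^[p] x = g ^ p * (⇑D)^[p] x + (⇑(g • D))^[p - 1] g * D x :=
    fun x => Hochschild.formula hp (⇑D) (⇑(g • D)) (map_add D) hD g hδ x
  by_cases hg : g = 0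
  · refine ⟨0, fun x => ?_⟩
    rw [H x, hg, zero_pow hp.ne_zero, zero_mul, zero_mul, zero_add, iterate_map_zero, zero_mul]
  · refine ⟨(g ^ p * c + (⇑(g • D))^[p - 1] g) / g, fun x => ?_⟩
    have e : (g ^ p * c + (⇑(g • D))^[p - 1] g) / g * (g * D x) =
        (g ^ p * c + (⇑(g • D))^[p - 1] g) * D x := by
      rw [← mul_assoc, div_mul_cancel₀ _ hg]
    rw [H x, hc, hδ, e]
    ring

end Summit.ResolutionOfSingularities.ResolutionOfSingularities.Theorems.FolLU

end
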